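import Summits.BirchSwinnertonDyer.Rank1Residual.GaloisImage.KuriharaLowerBoundAssembly
import Summits.BirchSwinnertonDyer.Rank1Residual.GaloisImage.KuriharaLValueVisibility
import Summits.BirchSwinnertonDyer.Rank1Residual.GaloisImage.KuriharaSelmerShaBookkeeping
import Literature.NumberTheory.EllipticCurves.BSDQuadraticDescentTorsionOddPartProofs
import HarnessLib

/-!
# (C20) at `p = 3`, datum currency: a Kurihara-number certificate of depth `j` at a Kolyvagin level
# of the shallow datum gives `ord₃(L(E,1)/Ω_E) ≤ ord₃ #Ш(E)[3^∞] + (j − 1)`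
# (team n1011, ROUTE-1 §20.4 / §24, sub-target R1-23 END THEOREM; skeleton `cells/n1011/skel/T-R1-23.md`; p18)

HONEST FRAMING (cell `b2b-bsdres`, run/shared/lean/b2b/bsd-rank1-residual/, verbatim in every
file): the goal of the cell is to DELETE the COMBINATION-SHAPED residual classes of the
Birch–Swinnerton-Dyer formula for ALL analytic-rank `≤ 1` elliptic curves over `ℚ` — "full BSD
formula for every rank `≤ 1` curve in class `C`" assembled STRICTLY from published theorems — so
that the rank-`≤ 1` remainder becomes exactly the CONSTRUCTION-SHAPED classes, which are TYPED
(missing-input `Prop`s), NOT attempted. This is not "finishing BSD". Team n1011 (N10/N11, the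
additive block `X4 ∧ p = 3`): research route; the END THEOREM of sub-route (a′) modulo NAMED typed
inputs, carried as explicit hypotheses (nothing is asserted): the two-level Kato–Kurihara dictionary
(PORT, p09 `KatoKuriharaDictionaryThreeAt₂`), the generators of `KS₁` and Sakamoto's Thm. 4.4 (2) at
the empty level of every deep datum (p13's instances of the [S24] facts), the Poitou–Tate families,
`hEP`, and the scalar transport (p11). No class theorem is claimed; nothing is booked; no mark moves.

## What and why

`padicValRat_le_of_certificate`: for `W/ℚ` globally minimal, additive at `3` with `3 ∤ c₃`, `ρ̄₃`
onto, `#E(ℚ₃)[3] = 3^t`, `E(ℚ)` finite and `Ш(E)` finite, a newform datum `P` with `3 ∤ c_P` and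
the period transfer, a shallow Kolyvagin datum `D` at depth `k` and a certificate at a level `n` of
`D` (`δ̃^{(j)}_n(ψ₀) ≠ 0`, `t + j ≤ k + 1`, the proper NON-EMPTY sub-level numbers vanish mod `3^j`,
the primes of `n` prime to the level of `P`), TOGETHER WITH the deep inputs at every depth `k′ ≥ k`
(data `D′_{k′}`, pinned reductions, the two-level dictionary, generators, Thm. 4.4 (2) at `∅`, PT
family, admissible `T`, finiteness, transport): there is `q ∈ ℚ` with `L(E,1)/Ω(W) = q` and
`ord₃ q ≤ ord₃ #Ш(E)[3^∞] + (j − 1)` — R23_endshape's conclusion.  Proof: `LValue.exists_lValue_witness`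
(`ord₃ q = v`, `δ̃_1 ≡ 3^v·unit`), trivial if `v < j`, else the ASSEMBLY at the depth
`k′ = max k (X + t + v)` (`3^X = #Ш[3^∞]` kills `Sel`, `SelmerSha.card_dvd_and_nsmul_eq_zero`) gives
`3^{v+1−j} ∣ #Sel_{3^{k′+1}} ∣ #Ш[3^∞] = 3^X`.  (B6) (r1 GEN 12 (R3), lead R5-45 (c), verbatim): on
`t = 1` rows supply `D ⊆ 𝒫_{k+1+t}`, `D′ ⊆ 𝒫_{k′+1+t}`; the [S24]-side inputs are then S24-DEEP
(R1-35).  The ℕ-product currency of R23_endshape (`Kato.IsKolyvaginProduct`, cyclicity flag) is the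
bridge (B1), not in this file.

References: C.-H. Kim, AJM 148 (2026) Thm. 1.9 (6), Thm. 3.13 [Kim2022StructureSelmer]; R. Sakamoto,
JTNB 36 (2024) Thm. 4.4 [Sakamoto2024]; B. Mazur, K. Rubin, Mem. AMS 799 (2004) Thm. 3.2.4, App. A
[MazurRubin2004]; K. Kato, Astérisque 295 (2004) Thm. 12.5 (1) [Kato2004Asterisque].
-/

noncomputable section

open scoped Classical NumberField ContRepresentation
open Function NumberField IsDedekindDomain WeierstrassCurve
  Literature.NumberTheory.EllipticCurves Literature.NumberTheory.EllipticCurves.ModularForms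
  Literature.NumberTheory.EllipticCurves.Rank1Residual
  Literature.NumberTheory.GaloisRepresentations
  Literature.NumberTheory.GaloisRepresentations.DiscreteGaloisModule Literature.NumberTheory.GaloisCohomology

namespace Summit.BirchSwinnertonDyer.Rank1Residual.GaloisImage.Assembly

/-- **(C20) at `p = 3` in datum currency — the END THEOREM of sub-route (a′) modulo its named typed
inputs** (module docstring; (B6): on `t = 1` rows supply `D ⊆ 𝒫_{k+1+t}`, `D′ ⊆ 𝒫_{k′+1+t}`).
[cite: Kim2022StructureSelmer, Thm. 1.9 (6) and Thm. 3.13] [cite: Sakamoto2024, Thm. 4.4 (p. 926)]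
[cite: MazurRubin2004, Thm. 3.2.4 and App. A (33)] -/
theorem padicValRat_le_of_certificate
    (W : WeierstrassCurve ℚ) [W.IsElliptic] [W.IsGloballyMinimal] (t k : ℕ)
    (D : KolyvaginDatum (W.torsionGaloisModule (((3 : ℕ) : ℤ) ^ k * ((3 : ℕ) : ℤ))))
    (v₃ : HeightOneSpectrum (𝓞 ℚ)) (hv₃ : ((3 : ℕ) : 𝓞 ℚ) ∈ v₃.asIdeal)
    -- the row
    (hadd : Addv W 3) (hc3 : ¬ 3 ∣ (W.baseChange ℚ_[3]).localTamagawaNumber ℤ_[3])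
    (hsurj : W.HasSurjectiveModNGaloisRep ((3 : ℕ) : ℤ))
    (ht : Nat.card {Q : (W.baseChange ℚ_[3]).toAffine.Point // (3 : ℕ) • Q = 0} = 3 ^ t)
    (hL : W.entireLFunction 1 ≠ 0) [Finite W.toAffine.Point] [Finite W.sha]
    {N : ℕ} [NeZero N] (P : ModularParametrizationData W N) (hcP : ¬ ((3 : ℕ) : ℤ) ∣ P.maninConstant)
    (hper : ∃ u : ℚ, ‖(u : ℚ_[3])‖ = 1 ∧ W.realPeriodRat = u * plusPeriod P.f)
    -- generator of `KS₁` at the shallow depth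
    (g : Finset (HeightOneSpectrum (𝓞 ℚ)) →
      galoisCohomology (W.torsionGaloisModule (((3 : ℕ) : ℤ) ^ k * ((3 : ℕ) : ℤ))) 1)
    (hgen : ∀ κ ∈ D.kolyvaginSystems (propagatedSelmerStructure W 3 k), ∃ a : ℕ, κ = a • g)
    -- the deep inputs, at every depth `k′`
    (D' : ∀ k' : ℕ, KolyvaginDatum (W.torsionGaloisModule (((3 : ℕ) : ℤ) ^ k' * ((3 : ℕ) : ℤ))))
    (red : ∀ k' : ℕ, (W.torsionGaloisModule (((3 : ℕ) : ℤ) ^ k' * ((3 : ℕ) : ℤ))).toContRepresentation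
      →ⁱL (W.torsionGaloisModule (((3 : ℕ) : ℤ) ^ k * ((3 : ℕ) : ℤ))).toContRepresentation)
    (hred : ∀ k', ∀ x : geomTorsion W (((3 : ℕ) : ℤ) ^ k' * ((3 : ℕ) : ℤ)),
      ((red k' x : geomTorsion W (((3 : ℕ) : ℤ) ^ k * ((3 : ℕ) : ℤ))) : geomPoints W) =
        (((3 : ℕ) : ℤ) ^ (k' - k)) • (x : geomPoints W))
    (hdict : ∀ k', k ≤ k' → KatoKuriharaDictionaryThreeAt₂ W t k k' D (D' k') (red k') v₃)
    (g' : ∀ k' : ℕ, Finset (HeightOneSpectrum (𝓞 ℚ)) →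
      galoisCohomology (W.torsionGaloisModule (((3 : ℕ) : ℤ) ^ k' * ((3 : ℕ) : ℤ))) 1)
    (hg' : ∀ k', g' k' ∈ (D' k').kolyvaginSystems (propagatedSelmerStructure W 3 k'))
    (hgen' : ∀ k', ∀ κ ∈ (D' k').kolyvaginSystems (propagatedSelmerStructure W 3 k'),
      ∃ a : ℕ, κ = a • g' k')
    (inv' : ∀ k' : ℕ, LocalInvariants ℚ (3 ^ (k' + 1))) (hperf' : ∀ k', (inv' k').IsPerfect)
    (hsum' : ∀ k', (inv' k').SumLocalTermEqZero) (hcompl' : ∀ k', (inv' k').SelmerComplement)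
    (hinj' : ∀ k', ∀ v : HeightOneSpectrum (𝓞 ℚ), Injective (inv' k' (Sum.inr v)))
    (hEP : ∀ v : HeightOneSpectrum (𝓞 ℚ), localEulerPoincareCharacteristic (v.adicCompletion ℚ))
    (T : ∀ k' : ℕ, Finset (HeightOneSpectrum (𝓞 ℚ))) (hv₃T : ∀ k', v₃ ∈ T k')
    (hT : ∀ k', ∀ v : HeightOneSpectrum (𝓞 ℚ), v ∉ T k' →
      (((3 ^ (k' + 1) : ℕ) : ℕ) : 𝓞 ℚ) ∉ v.asIdeal ∧
        GaloisRep.IsUnramifiedAt v (W.torsionGaloisModule (((3 : ℕ) : ℤ) ^ k' * ((3 : ℕ) : ℤ))))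
    (h𝓕T : ∀ k', (propagatedSelmerStructure W 3 k').IsUnramifiedOutside (finSupport (T k')))
    (h𝓚T : ∀ k', (W.kummerSelmerStructure (((3 : ℕ) : ℤ) ^ k' * ((3 : ℕ) : ℤ))).IsUnramifiedOutside
      (finSupport (T k')))
    (hfinT : ∀ k', Finite (geomTorsion W (((3 : ℕ) : ℤ) ^ k' * ((3 : ℕ) : ℤ))))
    (hfinS : ∀ k', Finite (W.kummerSelmerStructure (((3 : ℕ) : ℤ) ^ k' * ((3 : ℕ) : ℤ))).selmerGroup)
    (hR22 : ∀ k', (Nat.card ((inv' k').dualSelmerStructure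
          (W.torsionGaloisModule (((3 : ℕ) : ℤ) ^ k' * ((3 : ℕ) : ℤ)))
          (propagatedSelmerStructure W 3 k')).selmerGroup ∣ 3 ^ (k' + 1) →
        addOrderOf (g' k' ∅) * Nat.card ((inv' k').dualSelmerStructure
          (W.torsionGaloisModule (((3 : ℕ) : ℤ) ^ k' * ((3 : ℕ) : ℤ)))
            (propagatedSelmerStructure W 3 k')).selmerGroup = 3 ^ (k' + 1)) ∧
      (3 ^ (k' + 1) ∣ Nat.card ((inv' k').dualSelmerStructure
          (W.torsionGaloisModule (((3 : ℕ) : ℤ) ^ k' * ((3 : ℕ) : ℤ)))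
            (propagatedSelmerStructure W 3 k')).selmerGroup → g' k' ∅ = 0))
    (hNp : ∀ k', ∃ l, Nat.card ((inv' k').dualSelmerStructure
        (W.torsionGaloisModule (((3 : ℕ) : ℤ) ^ k' * ((3 : ℕ) : ℤ)))
          (propagatedSelmerStructure W 3 k')).selmerGroup = 3 ^ l)
    (htr : ∀ k', k ≤ k' → ∀ (κ' : Finset (HeightOneSpectrum (𝓞 ℚ)) →
        galoisCohomology (W.torsionGaloisModule (((3 : ℕ) : ℤ) ^ k * ((3 : ℕ) : ℤ))) 1)
      (κu' : Finset (HeightOneSpectrum (𝓞 ℚ)) →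
        galoisCohomology (W.torsionGaloisModule (((3 : ℕ) : ℤ) ^ k' * ((3 : ℕ) : ℤ))) 1)
      (a a' : ℕ), κ' ∈ D.kolyvaginSystems (propagatedSelmerStructure W 3 k) →
        κu' ∈ (D' k').kolyvaginSystems (propagatedSelmerStructure W 3 k') →
        κ' = a • g → κu' = a' • g' k' →
        (∀ d, (D' k').IsLevel d → D.IsLevel d → galoisCohomology.map (red k') 1 (κu' d) = κ' d) →
        ∀ s, s ≤ k + 1 → (3 ^ s ∣ a ↔ 3 ^ s ∣ a'))
    -- the certificate at a level `n` of `D`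
    (n : Finset (HeightOneSpectrum (𝓞 ℚ))) (hn : D.IsLevel n) {j : ℕ} (htj : t + j ≤ k + 1)
    (hPN : ∀ q ∈ n, (Ideal.absNorm q.asIdeal).Coprime N)
    {ψ₀ : (ℓ : ℕ) → (ZMod ℓ)ˣ →* Multiplicative (ZMod (3 ^ j))}
    (hψ₀ : ∀ q ∈ n, Function.Surjective (ψ₀ (Ideal.absNorm q.asIdeal)))
    (hcert : haveI : NeZero (∏ q ∈ n, Ideal.absNorm q.asIdeal) :=
        ⟨Finset.prod_ne_zero_iff.2 fun q _ => absNorm_ne_zero q⟩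
      kuriharaNumber P.f (3 ^ j) (∏ q ∈ n, Ideal.absNorm q.asIdeal) ψ₀ ≠ 0)
    (hv : ∀ c, c ⊂ n → c.Nonempty → ∀ ψ' : (ℓ : ℕ) → (ZMod ℓ)ˣ →* Multiplicative (ZMod (3 ^ j)),
      (∀ q ∈ c, Function.Surjective (ψ' (Ideal.absNorm q.asIdeal))) →
        haveI : NeZero (∏ q ∈ c, Ideal.absNorm q.asIdeal) :=
          ⟨Finset.prod_ne_zero_iff.2 fun q _ => absNorm_ne_zero q⟩
        kuriharaNumber P.f (3 ^ j) (∏ q ∈ c, Ideal.absNorm q.asIdeal) ψ' = 0) :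
    ∃ q : ℚ, W.entireLFunction 1 / (W.realPeriodRat : ℂ) = (q : ℂ) ∧
      padicValRat 3 q ≤
        (padicValNat 3 (Nat.card (AddCommGroup.primaryComponent W.sha 3)) : ℤ) + ((j - 1 : ℕ) : ℤ) := by
  haveI : Fact (Nat.Prime 3) := ⟨Nat.prime_three⟩
  haveI : NeZero ((3 : ℕ) : ℚ) := ⟨by norm_num⟩
  have hirr : W.HasIrreducibleModPGaloisRep 3 :=
    hasIrreducibleModPGaloisRep_of_hasSurjectiveModNGaloisRep W 3 hsurj
  -- the `L`-value witness
  obtain ⟨q, v, hq, hvq, hKur⟩ := LValue.exists_lValue_witness W 3 (by norm_num) hirr hL P hper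
  refine ⟨q, hq, ?_⟩
  rw [hvq]
  -- `#Ш[3^∞] = 3^X`
  set X := padicValNat 3 (Nat.card W.sha) with hXdef
  have hSha : Nat.card (AddCommGroup.primaryComponent W.sha 3) = 3 ^ X :=
    natCard_primaryComponent_eq_pow_padicValNat 3
  rw [hSha, padicValNat.prime_pow]
  -- trivial when `v < j`
  rcases Nat.lt_or_ge v j with hvj | hjv
  · have : (v : ℤ) ≤ ((j - 1 : ℕ) : ℤ) := by exact_mod_cast (by omega : v ≤ j - 1)
    have hX0 : (0 : ℤ) ≤ (X : ℤ) := by positivity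
    linarith
  -- the deep level
  set k' := max k (X + t + v) with hk'
  have hkk' : k ≤ k' := le_max_left _ _
  have hK : X + t + v < k' + 1 := Nat.lt_succ_of_le (le_max_right _ _)
  haveI := hfinT k'
  haveI := hfinS k'
  obtain ⟨hSdvd, hSkill⟩ := SelmerSha.card_dvd_and_nsmul_eq_zero W 3 hirr k'
  rw [hSha] at hSdvd hSkill
  -- the `3`-integrality of the symbols at the sub-levels of `n`
  have hden : ∀ d ⊆ n, ∀ a : ℕ,
      (ratPlusSymbol P.f ((a : ℚ) / (∏ q ∈ d, Ideal.absNorm q.asIdeal : ℕ))).den.Coprime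
        (3 ^ (k + 1)) := by
    intro d hd a
    refine LValue.coprime_den_ratPlusSymbol_of_coprime W 3 (by norm_num) hirr P ?_ (k + 1) a
    exact Nat.Coprime.prod_left fun q hq => hPN q (hd hq)
  -- hypothesis (v) at every proper sub-level, the empty one from `v ≥ j`
  have hv' : ∀ c, c ⊂ n → ∀ ψ' : (ℓ : ℕ) → (ZMod ℓ)ˣ →* Multiplicative (ZMod (3 ^ j)),
      (∀ q ∈ c, Function.Surjective (ψ' (Ideal.absNorm q.asIdeal))) →
        haveI : NeZero (∏ q ∈ c, Ideal.absNorm q.asIdeal) :=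
          ⟨Finset.prod_ne_zero_iff.2 fun q _ => absNorm_ne_zero q⟩
        kuriharaNumber P.f (3 ^ j) (∏ q ∈ c, Ideal.absNorm q.asIdeal) ψ' = 0 := by
    intro c hc ψ' hψ'
    rcases c.eq_empty_or_nonempty with rfl | hne
    · -- `δ̃_1^{(j)} = 3^v · unit = 0` in `ℤ/3^j` since `v ≥ j`
      obtain ⟨w₀, hw₀⟩ := hKur j
      have h1 : kuriharaNumber P.f (3 ^ j) 1 ψ' = 0 := by
        rw [hw₀ ψ', show ((3 ^ v : ℕ) : ZMod (3 ^ j)) = 0 from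
          (ZMod.natCast_eq_zero_iff _ _).2 (Nat.pow_dvd_pow 3 hjv), zero_mul]
      simpa using h1
    · exact hv c hc hne ψ' hψ'
  -- the ASSEMBLY at depth `k′`
  have hmain := pow_dvd_natCard_selmerGroup_of_certificate W t k k' hkk' D (D' k') (red k') (hred k')
    v₃ hv₃ hadd hc3 hsurj ht P hcP hper (hdict k' hkk') g hgen (g' k') (hg' k') (hgen' k') (inv' k')
    (hperf' k') (hsum' k') (hcompl' k') (hinj' k') hEP (T k') (hv₃T k') (hT k') (h𝓕T k') (h𝓚T k')
    (hR22 k') (hNp k') (htr k' hkk') n hn htj hden hψ₀ hcert hv' (hKur (k' + 1)) hSkill hK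
  -- `3^{v+1−j} ∣ #Sel ∣ 3^X`
  have h := (Nat.pow_dvd_pow_iff_le_right (by norm_num : 1 < 3)).1 (hmain.trans hSdvd)
  have : (v : ℤ) ≤ (X : ℤ) + ((j - 1 : ℕ) : ℤ) := by
    have h' : v + 1 - j ≤ X := h
    push_cast [Nat.sub_le_iff_le_add] at h' ⊢
    omega
  exact this

end Summit.BirchSwinnertonDyer.Rank1Residual.GaloisImage.Assembly

end
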